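import Summits.ABC.IUTFork.Joshi.ArithmeticoidsNumberFieldModel
import Summits.ABC.IUTFork.Joshi.ArithmeticoidFrobenioids
import Literature.NumberTheory.GaloisRepresentations.PadicEmbeddingPlaces
import Mathlib.FieldTheory.Finite.Basic
import HarnessLib

/-!
# The arithmetic model of `ATS2h.DeformationDatum` with ALGEBRAICALLY CLOSED fibres `K_{y_v} = (L̄, |σ_v(−)|)`:
# [J-2½] Prop. 5.15.1 (`Prop5151v2`) HOLDS there — half (b) of the honest non-vacuous verdict (block E, rung A2.E, seat E-t48)

PROOF-SIDE companion of seat E-t37's `Joshi/Arithmeticoids.lean` (p430482), seat E-t46's `Joshi/ArithmeticoidFrobenioids.lean`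
(claim-`Prop` `DeformationDatum.Prop5151v2` = K. Joshi, *Construction of Arithmetic Teichmüller Spaces II½*, arXiv:2305.10398
(unrefereed; bib `Joshi2023ATS2half`) Prop. 5.15.1, p.42 l.31–51, typed coordinatewise at `v ∉ V^arc`: «the value group of `K_{y_v}`
(Def. 5.14.2: naturally isomorphic to the value group of its tilt) is the perfection = divisible hull of `|L_v^×|` read through
`ι_{y_v}`», in log-coordinates `log|K_{y_v}^×| = ℚ·log|ι_{y_v}(L_v^×)|`), and of this seat's arithmetic model
`NumberFieldModel.model L` (p434710) and its Def. 4.1.1 re-basing `modelDef411` (sibling file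
`Joshi/ArithmeticoidsNumberFieldModelDef411.lean`, half (a): with fibres `K_{y_v} = L_v` the typed claim FAILS — `|L_v^×| = N𝔭^ℤ`
is discrete).

THIS FILE supplies the datum print actually has in mind at the fibres and shows the typed claim then HOLDS, for EVERY number field
`L` (Mathlib `NumberField L`), with everything else as in p434710 (all places `V = InfinitePlace L ⊕ FinitePlace L`, Artin–Whaples
`|−|_v`, Mathlib's PRODUCT FORMULA, `Y_v = ℤ` one Frobenius orbit, `act_v = ϕ_v^{ord_v}`):
* FIBRES: `K_{y_v} := (L̄, |−|_{v,y})`, `L̄ = AlgebraicClosure L` (ALGEBRAICALLY CLOSED, as Def. 5.1.1 wants; not complete — the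
  signature records no completeness), where the absolute value is pulled back along an `L`-embedding `σ_v : L̄ → ℚ̄_{p_v}`
  (`PadicAlgCl`, Mathlib's spectral norm) extending a `p_v`-adic embedding `τ_v : L → ℚ̄_{p_v}` WHOSE PLACE IS `v` — supplied by the
  tree's `Literature.NumberTheory.GaloisRepresentations.exists_embedding_place_eq` [Neukirch, ANT II (8.1)] — resp. along an
  `L`-embedding `σ_v : L̄ → ℂ` extending the place's complex embedding at `v ∣ ∞`; `ι_{y_v} : L_v → K_{y_v}` is `L ⊂ L̄`;
* NORMALISATION (5.3.3): `|x|_v = |ι(x)|_{K}^{α}` holds with the exponent `c_v > 0` of the tree's `exists_norm_eq_adicAbv_rpow`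
  (`‖τ_v a‖ = |a|_v^{c_v}`) folded into the fibre absolute value (`|−|_{v,y_n} := ‖σ_v(−)‖^{p_v^n / c_v}`, `α_v(y_n) = p_v^{−n}` as in
  p434710);
* VERDICT (`closureModel_prop5151v2`): **`Prop5151v2` HOLDS** — at a finite place `v = 𝔭 ∣ p`: every element of `ℚ̄_p^×` has
  absolute value in `p^ℚ` (Mathlib `spectralNorm_eq_norm_coeff_zero_rpow`: `‖u‖ = ‖a₀(u)‖_p^{1/deg u}`), and `L̄ ∋ p^{1/b}` for every
  `b ≥ 1` (`IsAlgClosed.exists_pow_nat_eq`), so `log|K_{y_v}^×| = ℚ·log p = ℚ·log|ι(L_v^×)|` (the latter because `p ∈ L_v^×` has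
  `‖τ_v p‖ = p⁻¹`). Together with half (a): `Prop5151v2` is INDEPENDENT of the 28-field signature and is decided exactly by the
  divisibility of `|K_{y_v}^×|`, i.e. by `K_{y_v}` being algebraically closed — print's unrecorded standing hypothesis.
No side taken on [IUTchIII] Cor. 3.12 or on any author; typed ≠ proved; a model exhibits satisfiability, nothing more. The
mathematics is [folklore] (extension of absolute values to `L̄` through `ℚ̄_p`/`ℂ`; value group of `ℚ̄_p`);
`[claim: Joshi2023ATS2half, status: disputed]` tags only the quoted claim-`Prop`s.
-/

noncomputable section

open NumberField IsDedekindDomain Literature.NumberTheory.GaloisRepresentations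

namespace Summit.ABC.IUTFork.Joshi.ATS2h

/-! ## 0. The norm of a normed field as a Bourbaki valued-field structure -/

namespace IsValuedField

/-- The norm of a normed field is a Bourbaki valued-field structure (constant `2`) as soon as it is non-trivial. [folklore] -/
theorem of_norm {F : Type} [NormedField F] (hnt : ∃ x : F, x ≠ 0 ∧ ‖x‖ ≠ 1) : IsValuedField (fun x : F => ‖x‖) := by
  simpa using IsValuedField.norm_pow (F := F) 1 one_ne_zero hnt

end IsValuedField

namespace NumberFieldModel

variable (L : Type) [Field L] [NumberField L]

/-! ## 1. The residue characteristic of a finite place lies in it; a `p_v`-adic embedding with place `v` -/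

/-- `N𝔭_w = p_w^f` with `p_w = resChar`: the absolute norm of a finite place is a power of its residue characteristic (the order
of the finite residue field `𝓞 L ⧸ 𝔭_w`). [folklore] -/
theorem exists_absNorm_eq_resChar_pow (w : FinitePlace L) :
    ∃ f : ℕ, 0 < f ∧ Ideal.absNorm w.maximalIdeal.asIdeal = resChar L (Sum.inr w) ^ f ∧
      ((resChar L (Sum.inr w) : ℕ) : 𝓞 L) ∈ w.maximalIdeal.asIdeal := by
  set P := w.maximalIdeal.asIdeal with hP
  haveI : P.IsMaximal := w.maximalIdeal.isMaximal
  letI : Field (𝓞 L ⧸ P) := Ideal.Quotient.field P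
  haveI : Finite (𝓞 L ⧸ P) := P.finiteQuotientOfFreeOfNeBot w.maximalIdeal.ne_bot
  letI : Fintype (𝓞 L ⧸ P) := Fintype.ofFinite _
  obtain ⟨n, hq, hcard⟩ := FiniteField.card (𝓞 L ⧸ P) (ringChar (𝓞 L ⧸ P))
  have hN : Ideal.absNorm P = ringChar (𝓞 L ⧸ P) ^ (n : ℕ) := by
    rw [Ideal.absNorm_apply, Submodule.cardQuot_apply, Nat.card_eq_fintype_card, hcard]
  have hres : resChar L (Sum.inr w) = ringChar (𝓞 L ⧸ P) := by
    change (Ideal.absNorm P).minFac = _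
    rw [hN, Nat.pow_minFac n.ne_zero, hq.minFac_eq]
  refine ⟨n, n.pos, by rw [hres]; exact hN, ?_⟩
  rw [hres, ← Ideal.Quotient.eq_zero_iff_mem, map_natCast]
  exact CharP.cast_eq_zero _ _

/-- The `Fact` that `p_w` is prime (a term, not an instance). [folklore] -/
theorem fact_resChar_prime (w : FinitePlace L) : Fact (resChar L (Sum.inr w)).Prime := ⟨resChar_prime L w⟩

/-- `ℚ̄_{p_w}` (Mathlib `PadicAlgCl`: the algebraic closure of `ℚ_{p_w}` with its spectral norm) at the finite place `w`. [folklore] -/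
abbrev Qbar (w : FinitePlace L) : Type := @PadicAlgCl (resChar L (Sum.inr w)) (fact_resChar_prime L w)

/-- **A `p_w`-adic embedding `τ_w : L → ℚ̄_{p_w}` whose place is `w`**, with its normalisation exponent: `‖τ_w a‖ = |a|_w^c`,
`c > 0` — from the tree's `PadicEmbedding.exists_embedding_place_eq` ([Neukirch, ANT Ch. II Thm. (8.1)]: every place above `p`
arises from an embedding into `ℚ̄_p`) and `PadicEmbedding.exists_norm_eq_adicAbv_rpow` ((8.3)). [folklore] -/
theorem exists_padicEmb (w : FinitePlace L) :
    ∃ τ : L →+* Qbar L w, ∃ c : ℝ, 0 < c ∧ ∀ a : L, ‖τ a‖ = (w a) ^ c := by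
  haveI := fact_resChar_prime L w
  obtain ⟨τ, hτ⟩ := PadicEmbedding.exists_embedding_place_eq (K := L) (p := resChar L (Sum.inr w)) w.maximalIdeal
    (exists_absNorm_eq_resChar_pow L w).choose_spec.2.2
  obtain ⟨c, hc, h⟩ := PadicEmbedding.exists_norm_eq_adicAbv_rpow τ
  refine ⟨τ, c, hc, fun a => ?_⟩
  rw [h a, hτ, ← FinitePlace.norm_embedding, FinitePlace.norm_embedding_eq]

/-- `τ_w : L → ℚ̄_{p_w}`, a `p_w`-adic embedding whose place is `w` (a choice). [folklore] -/
def padicEmb (w : FinitePlace L) : L →+* Qbar L w := (exists_padicEmb L w).choose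

/-- The normalisation exponent `c_w` with `‖τ_w a‖ = |a|_w^{c_w}` (a choice). [folklore] -/
def cexp (w : FinitePlace L) : ℝ := (exists_padicEmb L w).choose_spec.choose

/-- `c_w > 0`. [folklore] -/
theorem cexp_pos (w : FinitePlace L) : 0 < cexp L w := (exists_padicEmb L w).choose_spec.choose_spec.1

/-- `‖τ_w a‖ = |a|_w^{c_w}`. [folklore] -/
theorem norm_padicEmb (w : FinitePlace L) (a : L) : ‖padicEmb L w a‖ = (w a) ^ cexp L w :=
  (exists_padicEmb L w).choose_spec.choose_spec.2 a

/-! ## 2. The fibre fields: `L̄` with the absolute value pulled back from `ℚ̄_{p_v}` resp. `ℂ` -/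

/-- `σ_w : L̄ → ℚ̄_{p_w}`, an `L`-embedding of the algebraic closure extending `τ_w` (`IsAlgClosed.lift`). [folklore] -/
def sigmaFin (w : FinitePlace L) : AlgebraicClosure L →+* Qbar L w :=
  letI : Algebra L (Qbar L w) := (padicEmb L w).toAlgebra
  (IsAlgClosed.lift : AlgebraicClosure L →ₐ[L] Qbar L w).toRingHom

/-- `σ_w` extends `τ_w`. [folklore] -/
theorem sigmaFin_algebraMap (w : FinitePlace L) (x : L) :
    sigmaFin L w (algebraMap L (AlgebraicClosure L) x) = padicEmb L w x := by
  letI : Algebra L (Qbar L w) := (padicEmb L w).toAlgebra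
  exact (IsAlgClosed.lift : AlgebraicClosure L →ₐ[L] Qbar L w).commutes x

/-- `σ_w : L̄ → ℂ` at an infinite place `w`, an `L`-embedding extending the place's embedding `L → ℂ`. [folklore] -/
def sigmaInf (w : InfinitePlace L) : AlgebraicClosure L →+* ℂ :=
  letI : Algebra L ℂ := w.embedding.toAlgebra
  (IsAlgClosed.lift : AlgebraicClosure L →ₐ[L] ℂ).toRingHom

omit [NumberField L] in
/-- `σ_w` extends the embedding of the infinite place `w`. [folklore] -/
theorem sigmaInf_algebraMap (w : InfinitePlace L) (x : L) :
    sigmaInf L w (algebraMap L (AlgebraicClosure L) x) = w.embedding x := by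
  letI : Algebra L ℂ := w.embedding.toAlgebra
  exact (IsAlgClosed.lift : AlgebraicClosure L →ₐ[L] ℂ).commutes x

/-- The absolute value `|−|_v := ‖σ_v(−)‖` on `L̄` at the place `v` (an extension of a power of `|−|_v`). [folklore] -/
def closureAbs : (v : Place L) → AbsoluteValue (AlgebraicClosure L) ℝ
  | Sum.inl w => (NormedField.toAbsoluteValue ℂ).comp (sigmaInf L w).injective
  | Sum.inr w => (NormedField.toAbsoluteValue (Qbar L w)).comp (sigmaFin L w).injective

/-- The FIBRE FIELD `K_{y_v} := (L̄, |−|_v)` (Mathlib `WithAbs`: a normed field, hence a topological field). [folklore] -/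
abbrev Fib (v : Place L) : Type := WithAbs (closureAbs L v)

/-- The fibre fields ARE algebraically closed (they are `L̄` as fields) — the standing hypothesis of Def. 5.1.1 («an algebraically
closed perfectoid field») that the signature does not record and that half (a)'s fibres `L_v` lack. [folklore] -/
theorem fib_isAlgClosed (v : Place L) : IsAlgClosed (Fib L v) :=
  IsAlgClosed.of_ringEquiv (AlgebraicClosure L) (Fib L v) (WithAbs.equiv (closureAbs L v)).symm

/-- `‖z‖ = ‖σ_w z‖_ℂ` in the fibre at an infinite place. [folklore] -/
theorem norm_fib_inl (w : InfinitePlace L) (z : Fib L (Sum.inl w)) : ‖z‖ = ‖sigmaInf L w (WithAbs.equiv _ z)‖ := rfl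

/-- `‖z‖ = ‖σ_w z‖_{ℚ̄_p}` in the fibre at a finite place. [folklore] -/
theorem norm_fib_inr (w : FinitePlace L) (z : Fib L (Sum.inr w)) : ‖z‖ = ‖sigmaFin L w (WithAbs.equiv _ z)‖ := rfl

/-- `ι_{y_v} : L_v → K_{y_v}`, the inclusion `L ⊂ L̄` read between the synonyms. [folklore] -/
def embC (v : Place L) : Loc L v →+* Fib L v :=
  (WithAbs.equiv (closureAbs L v)).symm.toRingHom.comp
    ((algebraMap L (AlgebraicClosure L)).comp (WithAbs.equiv (absval L v)).toRingHom)

/-- `‖ι(x)‖ = w(x)` at an infinite place. [folklore] -/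
theorem norm_embC_inl (w : InfinitePlace L) (x : Loc L (Sum.inl w)) :
    ‖embC L (Sum.inl w) x‖ = w (WithAbs.equiv _ x) := by
  change ‖sigmaInf L w (algebraMap L (AlgebraicClosure L) (WithAbs.equiv _ x))‖ = _
  rw [sigmaInf_algebraMap, InfinitePlace.norm_embedding_eq]

/-- `‖ι(x)‖ = w(x)^{c_w}` at a finite place. [folklore] -/
theorem norm_embC_inr (w : FinitePlace L) (x : Loc L (Sum.inr w)) :
    ‖embC L (Sum.inr w) x‖ = (w (WithAbs.equiv _ x)) ^ cexp L w := by
  change ‖sigmaFin L w (algebraMap L (AlgebraicClosure L) (WithAbs.equiv _ x))‖ = _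
  rw [sigmaFin_algebraMap, norm_padicEmb]

/-- The exponent turning `‖ι(−)‖` back into `|−|_v`: `mult w` at an infinite place, `1/c_w` at a finite place. [folklore] -/
def expo : Place L → ℝ
  | Sum.inl w => w.mult
  | Sum.inr w => (cexp L w)⁻¹

/-- `expo v > 0`. [folklore] -/
theorem expo_pos (v : Place L) : 0 < expo L v := by
  rcases v with w | w
  · rw [expo]
    exact_mod_cast Nat.pos_of_ne_zero (InfinitePlace.mult_ne_zero (w := w))
  · rw [expo]
    exact inv_pos.2 (cexp_pos L w)

/-- `‖ι(x)‖^{expo v} = |x|_v` (the Artin–Whaples absolute value `absLoc` of p434710). [folklore] -/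
theorem norm_embC_rpow_expo (v : Place L) (x : Loc L v) : ‖embC L v x‖ ^ expo L v = absLoc L v x := by
  rcases v with w | w
  · rw [norm_embC_inl]
    change _ = ‖x‖ ^ w.mult
    rw [expo, Real.rpow_natCast]
    rfl
  · rw [norm_embC_inr, expo, Real.rpow_rpow_inv (apply_nonneg w _) (cexp_pos L w).ne']
    exact (absLoc_toLoc_inr L w (WithAbs.equiv _ x)).symm

/-- The fibre absolute value at the `n`-th point of the Frobenius orbit: `|z|_{v,y_n} := ‖z‖^{expo v · p_v^n}` (the rescaling
`p_v^n` along `ϕ_v` exactly as in p434710). [folklore] -/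
def absKC (v : Place L) (n : ℤ) (z : Fib L v) : ℝ := ‖z‖ ^ (expo L v * (resChar L v : ℝ) ^ n)

/-- The fibre norm is non-trivial: `‖ι(x)‖ ≠ 1` for some `x ∈ L`. [folklore] -/
theorem exists_norm_fib_ne_one (v : Place L) : ∃ z : Fib L v, z ≠ 0 ∧ ‖z‖ ≠ 1 := by
  obtain ⟨x, hx, h1⟩ := exists_norm_toLoc_ne_one L v
  refine ⟨embC L v (toLoc L v x), (map_ne_zero _).2 ((map_ne_zero _).2 hx), fun h => h1 ?_⟩
  have habs : absLoc L v (toLoc L v x) = 1 := by rw [← norm_embC_rpow_expo, h, Real.one_rpow]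
  have hw : ‖toLoc L v x‖ ^ weight L v = 1 := habs
  exact (pow_eq_one_iff_of_nonneg (norm_nonneg _) (weight_ne_zero L v)).1 hw

/-- `(K_{y_v}, |−|_{v,y})` is a Bourbaki valued field. [folklore] -/
theorem absKC_isValuedField (v : Place L) (n : ℤ) : IsValuedField (absKC L v n) :=
  (IsValuedField.of_norm (exists_norm_fib_ne_one L v)).rpow (mul_pos (expo_pos L v) (resChar_zpow_pos L v n))

/-! ## 3. The model with algebraically closed fibres -/

/-- **THE ARITHMETIC MODEL WITH ALGEBRAICALLY CLOSED FIBRES** of `DeformationDatum` for the number field `L`: p434710's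
`model L` (all places, Artin–Whaples absolute values, product formula, `Y_v = ℤ`, `act_v = ϕ_v^{ord_v}`) with `base := algClosure`
(Def. 4.1.1) and the fibres replaced by `K_{y_v} = (L̄, ‖σ_v(−)‖^{expo v · p_v^n})`, `ι_{y_v} = (L ⊂ L̄)`, `α_v(y_n) = p_v^{−n}`.
[folklore] -/
def closureModel : DeformationDatum L (Place L) (Loc L) (fun _ => ℤ) (fun v _ => Fib L v) (fun _ => Unit) (fun _ => Unit) :=
  { model L with
    base := TiltBase.algClosure
    absK := absKC L
    absK_isValuedField := absKC_isValuedField L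
    emb := fun v _ => embC L v
    absLv_eq_rpow := fun v n x => by
      change absLoc L v x = (‖embC L v x‖ ^ (expo L v * (resChar L v : ℝ) ^ n)) ^ ((resChar L v : ℝ) ^ n)⁻¹
      rw [Real.rpow_mul (norm_nonneg _), Real.rpow_rpow_inv (Real.rpow_nonneg (norm_nonneg _) _)
        (resChar_zpow_pos L v n).ne', norm_embC_rpow_expo] }

/-- The model IS a Def. 4.1.1 datum (`IsDef411`): `Prop5151v2` is contentful at it. [folklore] -/
theorem closureModel_isDef411 : (closureModel L).IsDef411 := rfl

/-- Unfolding: the fibre absolute value. [folklore] -/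
theorem closureModel_absK (v : Place L) (n : ℤ) (z : Fib L v) :
    (closureModel L).absK v n z = ‖z‖ ^ (expo L v * (resChar L v : ℝ) ^ n) := rfl

/-- Unfolding: the untilt structure map. [folklore] -/
theorem closureModel_emb (v : Place L) (n : ℤ) : (closureModel L).emb v n = embC L v := rfl

/-! ## 4. Value groups: `|ℚ̄_p^×| = p^ℚ`, and `L̄` contains all roots of `p` -/

/-- Every non-zero element of `ℚ̄_p` has absolute value a RATIONAL power of `p`: `‖u‖ = ‖a₀‖_p^{1/deg u}` for the constant
coefficient `a₀ ≠ 0` of its minimal polynomial (Mathlib `spectralNorm_eq_norm_coeff_zero_rpow`) and `‖a₀‖_p ∈ p^ℤ`. [folklore] -/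
theorem exists_log_norm_eq_rat_mul {p : ℕ} [Fact p.Prime] {u : PadicAlgCl p} (hu : u ≠ 0) :
    ∃ r : ℚ, Real.log ‖u‖ = r * Real.log p := by
  have hint : IsIntegral ℚ_[p] u := Algebra.IsIntegral.isIntegral u
  have h0 : (minpoly ℚ_[p] u).coeff 0 ≠ 0 := minpoly.coeff_zero_ne_zero hint hu
  have hsp : ‖u‖ = ‖(minpoly ℚ_[p] u).coeff 0‖ ^ (1 / (minpoly ℚ_[p] u).natDegree : ℝ) := by
    rw [← PadicAlgCl.spectralNorm_eq]
    exact spectralNorm.spectralNorm_eq_norm_coeff_zero_rpow ℚ_[p] (PadicAlgCl p) u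
  refine ⟨-((minpoly ℚ_[p] u).coeff 0).valuation / (minpoly ℚ_[p] u).natDegree, ?_⟩
  have hp : (0 : ℝ) < p := by exact_mod_cast (Fact.out : p.Prime).pos
  rw [hsp, Padic.norm_eq_zpow_neg_valuation h0, ← Real.rpow_intCast, ← Real.rpow_mul hp.le, Real.log_rpow hp]
  push_cast
  ring

/-- For every `b ≥ 1` the fibre at a finite place `w ∣ p` contains a `z ≠ 0` with `b·log‖z‖ = −log p` (a `b`-th root of `p` in
`L̄`, read through `σ_w`; `‖τ_w p‖ = p⁻¹`). [folklore] -/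
theorem exists_norm_fib_root (w : FinitePlace L) {b : ℕ} (hb : 0 < b) :
    ∃ z : Fib L (Sum.inr w), z ≠ 0 ∧ (b : ℝ) * Real.log ‖z‖ = -Real.log (resChar L (Sum.inr w)) := by
  haveI := fact_resChar_prime L w
  set p := resChar L (Sum.inr w) with hp
  obtain ⟨ζ, hζ⟩ := IsAlgClosed.exists_pow_nat_eq (algebraMap L (AlgebraicClosure L) (p : L)) hb
  have hp0 : (p : L) ≠ 0 := Nat.cast_ne_zero.2 (Fact.out : p.Prime).ne_zero
  have hζ0 : ζ ≠ 0 := by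
    intro h; rw [h, zero_pow hb.ne'] at hζ; exact ((map_ne_zero _).2 hp0) hζ.symm
  refine ⟨(WithAbs.equiv _).symm ζ, (map_ne_zero _).2 hζ0, ?_⟩
  have hnorm : ‖sigmaFin L w ζ‖ ^ b = (p : ℝ)⁻¹ := by
    rw [← norm_pow, ← map_pow, hζ, sigmaFin_algebraMap, map_natCast]
    have : ((p : ℕ) : Qbar L w) = ((p : ℚ_[p]) : Qbar L w) := by rw [map_natCast]
    rw [this, PadicAlgCl.norm_extends, Padic.norm_p]
  rw [norm_fib_inr, RingEquiv.apply_symm_apply, ← Real.log_pow, hnorm, Real.log_inv]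

/-! ## 5. Verdict: `Prop5151v2` HOLDS at the model with algebraically closed fibres -/

/-- **[J-2½] Prop. 5.15.1 as typed (`Prop5151v2`) HOLDS at the arithmetic model with algebraically closed fibres, for EVERY number
field `L`:** at every point `y` and every finite place `v = 𝔭 ∣ p`, `log|K_{y_v}^×| = ℚ·log|ι_{y_v}(L_v^×)|` inside `ℝ` — both sides
equal `(expo·p^n)·ℚ·log p` (`exists_log_norm_eq_rat_mul`, `exists_norm_fib_root`, and `p ∈ L_v^×` with `‖τ_v p‖ = p⁻¹`). With half
(a) (`not_modelDef411_prop5151v2`, fibres `L_v`: FALSE) this exhibits `Prop5151v2` as INDEPENDENT of the signature, decided by the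
algebraic closedness of the fibres. [claim: Joshi2023ATS2half, status: disputed] -/
theorem closureModel_prop5151v2 : (closureModel L).Prop5151v2 := by
  intro _ y v hv
  obtain ⟨w, rfl⟩ : ∃ w : FinitePlace L, v = Sum.inr w := by
    rcases v with w | w
    · exact (hv (inl_mem_arch L w)).elim
    · exact ⟨w, rfl⟩
  haveI := fact_resChar_prime L w
  have hprime : (resChar L (Sum.inr w)).Prime := resChar_prime L w
  -- the reference element `p ∈ L_v^×`: `log ‖ι(p)‖ = log ‖τ_w p‖ = -log p`
  have hpL : (resChar L (Sum.inr w) : L) ≠ 0 := Nat.cast_ne_zero.2 hprime.ne_zero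
  have hpLoc : toLoc L (Sum.inr w) (resChar L (Sum.inr w) : L) ≠ 0 := (map_ne_zero _).2 hpL
  have hnp : Real.log ‖embC L (Sum.inr w) (toLoc L (Sum.inr w) (resChar L (Sum.inr w) : L))‖ =
      -Real.log (resChar L (Sum.inr w)) := by
    change Real.log ‖sigmaFin L w (algebraMap L (AlgebraicClosure L)
      (WithAbs.equiv _ (toLoc L (Sum.inr w) (resChar L (Sum.inr w) : L))))‖ = _
    have h1 : WithAbs.equiv _ (toLoc L (Sum.inr w) (resChar L (Sum.inr w) : L)) = (resChar L (Sum.inr w) : L) := by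
      rw [map_natCast, map_natCast]
    rw [h1, sigmaFin_algebraMap, map_natCast]
    have h2 : ((resChar L (Sum.inr w) : ℕ) : Qbar L w) = ((resChar L (Sum.inr w) : ℚ_[resChar L (Sum.inr w)]) : Qbar L w) := by
      rw [map_natCast]
    rw [h2, PadicAlgCl.norm_extends, Padic.norm_p, Real.log_inv]
  ext r
  constructor
  · -- `⊆`: `log|z|_{v,y} = (expo·p^n)·log‖σ_w z‖ ∈ (expo·p^n)·ℚ·log p`
    rintro ⟨z, rfl⟩
    have hzF : (z : Fib L (Sum.inr w)) ≠ 0 := z.ne_zero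
    have hz0 : sigmaFin L w (WithAbs.equiv _ (z : Fib L (Sum.inr w))) ≠ 0 := (map_ne_zero _).2 ((map_ne_zero _).2 hzF)
    obtain ⟨s, hs⟩ := exists_log_norm_eq_rat_mul hz0
    refine ⟨Units.mk0 _ hpLoc, -s, ?_⟩
    rw [Units.val_mk0, closureModel_emb, closureModel_absK, closureModel_absK, Real.log_rpow (norm_pos_iff.2 hzF),
      Real.log_rpow (norm_pos_iff.2 ((map_ne_zero _).2 hpLoc)), hnp, norm_fib_inr, hs]
    push_cast
    ring
  · -- `⊇`: `q·log|ι(x)|_{v,y} = (expo·p^n)·t·log p` with `t ∈ ℚ`, realised by a power of a `t.den`-th root of `p` in `L̄`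
    rintro ⟨x, q, rfl⟩
    have hxF : embC L (Sum.inr w) (x : Loc L (Sum.inr w)) ≠ 0 := (map_ne_zero _).2 x.ne_zero
    have hτ0 : sigmaFin L w (WithAbs.equiv _ (embC L (Sum.inr w) (x : Loc L (Sum.inr w)))) ≠ 0 :=
      (map_ne_zero _).2 ((map_ne_zero _).2 hxF)
    obtain ⟨s₁, hs₁⟩ := exists_log_norm_eq_rat_mul hτ0
    rw [← norm_fib_inr] at hs₁
    obtain ⟨z₀, hz₀, hroot⟩ := exists_norm_fib_root L w (q * s₁).pos
    have hzt : (z₀ ^ (-(q * s₁).num) : Fib L (Sum.inr w)) ≠ 0 := zpow_ne_zero _ hz₀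
    refine ⟨Units.mk0 _ hzt, ?_⟩
    rw [Units.val_mk0, closureModel_emb, closureModel_absK, closureModel_absK, Real.log_rpow (norm_pos_iff.2 hzt),
      Real.log_rpow (norm_pos_iff.2 hxF), norm_zpow, Real.log_zpow, hs₁]
    have hlp : Real.log (resChar L (Sum.inr w) : ℝ) = -(((q * s₁).den : ℝ) * Real.log ‖z₀‖) := by linarith [hroot]
    have hden : ((q * s₁).den : ℝ) ≠ 0 := by exact_mod_cast (q * s₁).den_ne_zero
    have hnum : (q : ℝ) * s₁ * (q * s₁).den = (q * s₁).num := by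
      have h1 : (((q * s₁).num : ℚ) : ℝ) / (((q * s₁).den : ℚ) : ℝ) = ((q * s₁ : ℚ) : ℝ) := by
        rw [← Rat.cast_div, Rat.num_div_den]
      push_cast at h1
      rw [← h1, div_mul_cancel₀ _ hden]
    push_cast
    linear_combination (-(expo L (Sum.inr w) * (resChar L (Sum.inr w) : ℝ) ^ y (Sum.inr w)) * (q : ℝ) * (s₁ : ℝ)) * hlp
      + (expo L (Sum.inr w) * (resChar L (Sum.inr w) : ℝ) ^ y (Sum.inr w) * Real.log ‖z₀‖) * hnum

/-- Transfers from p434710 (fields other than the fibres are verbatim): Thm. 4.2.3 (4) `LActsByFrobeniusPowers` HOLDS at the model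
(by construction of `act`). [claim: Joshi2023ATS2half, status: disputed] -/
theorem closureModel_lActsByFrobeniusPowers : (closureModel L).LActsByFrobeniusPowers := by
  intro v _ x
  rfl

end NumberFieldModel

end Summit.ABC.IUTFork.Joshi.ATS2h

end
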